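import Summits.ValiantsHypothesis.ValiantsHypothesis.Theorems.LacunarySymmetroidMatrixDescartesCensusDoorA34PlaneCompression

/-!
# `MatrixDescartes` census — DOOR A at `(3,4)`: TOTALLY ISOTROPIC PLANES of the top letter (chart-free isotropic frame) — on a plane where `S₃`
# vanishes the compression of the FOUR-letter pencil is a THREE-letter compression: its sign along the det-roots is the root type and changes
# at most FIVE times

HONEST FRAMING.  Object-search cell `pub-symmetroid`, engine seat `val-sym-eng-2` (g6); helper rows beside the registered strata line
`Cruxes/DoorA34/Lines/strata.lean` on stmt-ValiantsHypothesis-19980 (`DoorA34 = PosRootLawAt 3 4 18`: OPEN, typed, never asserted here), stub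
`stub_nullTopCeiling`.  Chart-free companion of …SheetIsotropicFrame (which works in the hyperbolic normal form): let `Q` be a real `3 × 2` matrix
with `Qᵀ S₃ Q = 0` — a plane on which the top letter VANISHES.  Such planes of rank two exist exactly when `S₃` is singular and not definite on a
complement of its kernel: for the INDEFINITE rank-two top letter (the cell of every null-top seventeen of record) they are the two planes
`⟨k, w⟩`, `k` the kernel vector and `w` one of the two isotropic directions; for a rank-one top letter the plane `v^⊥`.  Then, for ANY support and
ANY lower letters (…PlaneCompression's `K = 3` bookkeeping does the work):

* `compress_eval_eq_core_of_top_vanish` — `Qᵀ F(x) Q = Qᵀ G(x) Q`, `G = S₀ + x^{d₁}S₁ + x^{d₂}S₂` the three-letter core: `d₃` disappears;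
* **`sgnChanges_isoPlane_compress_le_five`** — along ANY strictly increasing list of positive reals at which `det (Qᵀ F(x) Q) ≠ 0` the sign of
  this compression determinant changes at most `5` times (it is a `2 × 2` THREE-letter pencil determinant: six pair sums);
* **`type_iff_isoPlane_compress`** — at a real det-root `r` with `det (Qᵀ F(r) Q) ≠ 0` the ROOT TYPE `tr adj F(r)` (…RootRank/…RootType: `+`
  semidefinite, `−` indefinite real line pair) is non-zero and has the SIGN of `det (Qᵀ F(r) Q)`;
* **`sgnChanges_type_le_five_of_isoPlane`** — hence along any increasing list of positive det-roots at which the isotropic-plane compression is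
  non-degenerate, the TYPE changes at most FIVE times (the full-sheet bound is nine, `sgnChanges_type_le_nine_of_nineteen`).

LOCATED (seat report HOME/DOOR-A34-ENG2G6-REPORT.md §3; exact rational arithmetic on the kernel objects): every many-root object of record at `(3,4)` —
the census eighteens p584262 `(0,1,4,100)` and p584764 `(0,1,4,66)`, the null-top seventeens p559152 `(0,1,4,359)` and p584238 `(0,1,4,100)`, the
null-null sixteen p583093 — has ALL its det-roots of middle type (`tr adj F(r) < 0`; inertia walk `…,1,2,1,2,…`; ZERO type changes; never semidefinite).
Nothing here bounds any count; `DoorA34` and the three stubs stay OPEN; registers unchanged; nothing on `MatrixDescartes` (stmt-ValiantsHypothesis-18050) or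
`VP ≠ VNP` — VP≠VNP not moved.  [folklore] compression bookkeeping + Descartes along points.
-/

-- `Summit.ValiantsHypothesis.ValiantsHypothesis.…` repeats a component by the D-0017 layout
-- (single-conjunct summit), which the `dupNamespace` linter flags; the name is mandated.
set_option linter.dupNamespace false

namespace Summit.ValiantsHypothesis.ValiantsHypothesis.Theorems.LacunarySymmetroidMatrixDescartes.Census

open Polynomial Finset
open scoped BigOperators Polynomial Matrix
open Summit.ValiantsHypothesis.ValiantsHypothesis.Theorems.KPlusLogSqLaw.WindowDescartes (sgnChanges firstNZ firstNZ_cons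
  sgnChanges_eval_le_signVariations)

/-- **On a plane where the top letter vanishes the compression of the four-letter pencil is the compression of its three-letter core.** [folklore] -/
theorem compress_eval_eq_core_of_top_vanish (d : Fin 4 → ℕ) (S : Fin 4 → Matrix (Fin 3) (Fin 3) ℝ) (Q : Matrix (Fin 3) (Fin 2) ℝ)
    (hQ : Qᵀ * S 3 * Q = 0) (x : ℝ) :
    Qᵀ * (∑ l, x ^ d l • S l) * Q = Qᵀ * (∑ l : Fin 3, x ^ d (Fin.castSucc l) • S (Fin.castSucc l)) * Q := by
  rw [Fin.sum_univ_castSucc, Matrix.mul_add, Matrix.add_mul, Matrix.mul_smul, Matrix.smul_mul]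
  have h3 : (Fin.last 3 : Fin 4) = 3 := rfl
  rw [h3, hQ, smul_zero, add_zero]

/-- **TYPE-CHANGE LAW, chart-free.**  If `Qᵀ S₃ Q = 0`, then along any strictly increasing list of positive reals at which `det (Qᵀ F(x) Q) ≠ 0`
its sign changes at most `5` times. [folklore] -/
theorem sgnChanges_isoPlane_compress_le_five (d : Fin 4 → ℕ) (S : Fin 4 → Matrix (Fin 3) (Fin 3) ℝ) (Q : Matrix (Fin 3) (Fin 2) ℝ)
    (hQ : Qᵀ * S 3 * Q = 0) (xs : List ℝ) (hsort : xs.Pairwise (· < ·)) (hpos : ∀ x ∈ xs, 0 < x)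
    (hne : ∀ x ∈ xs, (Qᵀ * (∑ l, x ^ d l • S l) * Q).det ≠ 0) :
    sgnChanges (xs.map fun x => (Qᵀ * (∑ l, x ^ d l • S l) * Q).det) ≤ 5 := by
  have hmap : (xs.map fun x => (Qᵀ * (∑ l, x ^ d l • S l) * Q).det)
      = xs.map fun x => (Qᵀ * (∑ l : Fin 3, x ^ (fun l : Fin 3 => d (Fin.castSucc l)) l • (fun l : Fin 3 => S (Fin.castSucc l)) l) * Q).det := by
    refine List.map_congr_left fun x _ => ?_
    rw [compress_eval_eq_core_of_top_vanish d S Q hQ x]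
  rw [hmap]
  refine sgnChanges_det_compress_le_five (fun l : Fin 3 => d (Fin.castSucc l)) (fun l : Fin 3 => S (Fin.castSucc l)) Q xs hsort hpos ?_
  intro x hx
  have h := hne x hx
  rw [compress_eval_eq_core_of_top_vanish d S Q hQ x] at h
  exact h

/-- The value of `det F` at a real root, in matrix form. [folklore] -/
theorem det_pencil_eval_eq_zero_of_isRoot (d : Fin 4 → ℕ) (S : Fin 4 → Matrix (Fin 3) (Fin 3) ℝ) {r : ℝ}
    (hr : (Matrix.det (∑ l, ((X : ℝ[X]) ^ d l) • (S l).map C)).IsRoot r) : (∑ l, r ^ d l • S l).det = 0 := by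
  have h := hr
  rw [Polynomial.IsRoot.def, ← Polynomial.coe_evalRingHom, RingHom.map_det, RingHom.mapMatrix_apply,
    Polynomial.coe_evalRingHom, map_eval_pencil] at h
  exact h

/-- **THE TYPE IS THE SIGN OF A NON-DEGENERATE PLANE COMPRESSION.**  Symmetric letters, `r` a real det-root, `Q` ANY `3 × 2` real matrix with
`det (Qᵀ F(r) Q) ≠ 0`: then `tr adj F(r) ≠ 0` and `tr adj F(r) > 0 ↔ det (Qᵀ F(r) Q) > 0`, `tr adj F(r) < 0 ↔ det (Qᵀ F(r) Q) < 0`. [folklore] -/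
theorem type_iff_plane_compress (d : Fin 4 → ℕ) (S : Fin 4 → Matrix (Fin 3) (Fin 3) ℝ) (hS : ∀ l, (S l).IsSymm) {r : ℝ}
    (hr : (Matrix.det (∑ l, ((X : ℝ[X]) ^ d l) • (S l).map C)).IsRoot r) (Q : Matrix (Fin 3) (Fin 2) ℝ)
    (hQ : (Qᵀ * (∑ l, r ^ d l • S l) * Q).det ≠ 0) :
    (0 < (∑ l, r ^ d l • S l).adjugate.trace ↔ 0 < (Qᵀ * (∑ l, r ^ d l • S l) * Q).det) ∧
      ((∑ l, r ^ d l • S l).adjugate.trace < 0 ↔ (Qᵀ * (∑ l, r ^ d l • S l) * Q).det < 0) := by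
  set A := ∑ l, r ^ d l • S l with hA
  have hsym : A.IsSymm := isSymm_pencil_eval d hS r
  have hdet : A.det = 0 := det_pencil_eval_eq_zero_of_isRoot d S hr
  have hprod := trace_adjugate_mul_det_compress_nonneg hsym hdet Q
  -- `tr adj A ≠ 0`: the compression is `nᵀ adj A n`, non-zero, so `adj A ≠ 0`
  have hadj : A.adjugate ≠ 0 := by
    intro h0
    apply hQ
    rw [det_compress_eq_quadForm_adjugate, h0, Matrix.zero_mulVec, dotProduct_zero]
  have htr : A.adjugate.trace ≠ 0 := trace_adjugate_ne_zero_of_isSymm hsym hdet hadj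
  rcases lt_or_gt_of_ne hQ with hn | hp
  · have ht : A.adjugate.trace < 0 := by
      rcases lt_or_gt_of_ne htr with h | h
      · exact h
      · exact absurd hprod (not_le.mpr (mul_neg_of_pos_of_neg h hn))
    exact ⟨⟨fun h => absurd h (not_lt.mpr ht.le), fun h => absurd h (not_lt.mpr hn.le)⟩, ⟨fun _ => hn, fun _ => ht⟩⟩
  · have ht : 0 < A.adjugate.trace := by
      rcases lt_or_gt_of_ne htr with h | h
      · exact absurd hprod (not_le.mpr (mul_neg_of_neg_of_pos h hp))
      · exact h
    exact ⟨⟨fun _ => hp, fun _ => ht⟩, ⟨fun h => absurd h (not_lt.mpr ht.le), fun h => absurd h (not_lt.mpr hp.le)⟩⟩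

/-- `firstNZ` respects pointwise strict-sign equivalence. [folklore] -/
theorem firstNZ_sameSign : ∀ {l₁ l₂ : List ℝ},
    List.Forall₂ (fun a b => (0 < a ↔ 0 < b) ∧ (a < 0 ↔ b < 0)) l₁ l₂ →
    (0 < firstNZ l₁ ↔ 0 < firstNZ l₂) ∧ (firstNZ l₁ < 0 ↔ firstNZ l₂ < 0)
  | _, _, List.Forall₂.nil => by simp
  | _, _, @List.Forall₂.cons _ _ _ a b t u hab htu => by
    have ih := firstNZ_sameSign htu
    have hz : a = 0 ↔ b = 0 := by
      constructor
      · intro ha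
        rcases lt_trichotomy b 0 with hb | hb | hb
        · exact absurd (hab.2.mpr hb) (by rw [ha]; exact lt_irrefl 0)
        · exact hb
        · exact absurd (hab.1.mpr hb) (by rw [ha]; exact lt_irrefl 0)
      · intro hb
        rcases lt_trichotomy a 0 with ha | ha | ha
        · exact absurd (hab.2.mp ha) (by rw [hb]; exact lt_irrefl 0)
        · exact ha
        · exact absurd (hab.1.mp ha) (by rw [hb]; exact lt_irrefl 0)
    rw [firstNZ_cons, firstNZ_cons]
    by_cases ha : a = 0
    · rw [if_pos ha, if_pos (hz.mp ha)]; exact ih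
    · rw [if_neg ha, if_neg (fun hb => ha (hz.mpr hb))]; exact hab

/-- `sgnChanges` is invariant under replacing each entry by one of the same strict sign. [folklore] -/
theorem sgnChanges_congr_of_sameSign : ∀ {l₁ l₂ : List ℝ},
    List.Forall₂ (fun a b => (0 < a ↔ 0 < b) ∧ (a < 0 ↔ b < 0)) l₁ l₂ → sgnChanges l₁ = sgnChanges l₂
  | _, _, List.Forall₂.nil => rfl
  | _, _, @List.Forall₂.cons _ _ _ a b t u hab htu => by
    have ih := sgnChanges_congr_of_sameSign htu
    have hf := firstNZ_sameSign htu
    have key : a * firstNZ t < 0 ↔ b * firstNZ u < 0 := by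
      constructor
      · intro h
        rcases mul_neg_iff.mp h with ⟨h1, h2⟩ | ⟨h1, h2⟩
        · exact mul_neg_of_pos_of_neg (hab.1.mp h1) (hf.2.mp h2)
        · exact mul_neg_of_neg_of_pos (hab.2.mp h1) (hf.1.mp h2)
      · intro h
        rcases mul_neg_iff.mp h with ⟨h1, h2⟩ | ⟨h1, h2⟩
        · exact mul_neg_of_pos_of_neg (hab.1.mpr h1) (hf.2.mpr h2)
        · exact mul_neg_of_neg_of_pos (hab.2.mpr h1) (hf.1.mpr h2)
    show sgnChanges t + (if a * firstNZ t < 0 then 1 else 0) = sgnChanges u + (if b * firstNZ u < 0 then 1 else 0)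
    rw [ih]
    by_cases h : a * firstNZ t < 0
    · rw [if_pos h, if_pos (key.mp h)]
    · rw [if_neg h, if_neg (fun h' => h (key.mpr h'))]

/-- **AT MOST FIVE CHANGES OF TYPE along the roots seen by an isotropic plane.**  Symmetric letters, `Qᵀ S₃ Q = 0`, `xs` a strictly increasing
list of positive det-roots at each of which `det (Qᵀ F(r) Q) ≠ 0`: the list of root types `tr adj F(r)` has at most `5` sign changes. [folklore] -/
theorem sgnChanges_type_le_five_of_isoPlane (d : Fin 4 → ℕ) (S : Fin 4 → Matrix (Fin 3) (Fin 3) ℝ) (hS : ∀ l, (S l).IsSymm)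
    (Q : Matrix (Fin 3) (Fin 2) ℝ) (hQ : Qᵀ * S 3 * Q = 0) (xs : List ℝ) (hsort : xs.Pairwise (· < ·))
    (hroots : ∀ x ∈ xs, 0 < x ∧ (Matrix.det (∑ l, ((X : ℝ[X]) ^ d l) • (S l).map C)).IsRoot x)
    (hne : ∀ x ∈ xs, (Qᵀ * (∑ l, x ^ d l • S l) * Q).det ≠ 0) :
    sgnChanges (xs.map fun t => (∑ l, t ^ d l • S l).adjugate.trace) ≤ 5 := by
  have heq : sgnChanges (xs.map fun t => (∑ l, t ^ d l • S l).adjugate.trace)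
      = sgnChanges (xs.map fun x => (Qᵀ * (∑ l, x ^ d l • S l) * Q).det) := by
    refine sgnChanges_congr_of_sameSign ?_
    rw [List.forall₂_map_left_iff, List.forall₂_map_right_iff, List.forall₂_same]
    intro x hx
    exact type_iff_plane_compress d S hS (hroots x hx).2 Q (hne x hx)
  rw [heq]
  exact sgnChanges_isoPlane_compress_le_five d S Q hQ xs hsort (fun x hx => (hroots x hx).1) hne

end Summit.ValiantsHypothesis.ValiantsHypothesis.Theorems.LacunarySymmetroidMatrixDescartes.Census
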